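import Summits.Parity.GeneralizedHardyLittlewood.Theorems.PrimeLevelFamEdgeMomentsBeyondDiagonalFirstOrderOffDiagIntegrated
import Literature.NumberTheory.LFunctions.KowalskiMichelPeterssonFormulaHolds
import HarnessLib

/-!
# The off-diagonal of the order-`k` twisted harmonic first moment is `≪_k (1 + log N)^{k+4} √m / N`
# (helper for crux K_A `PrimeLevelFamEdge.MomentsBeyondDiagonal`, stmt-Parity-20007, stub `stub_first : SubFirst` ∀`Q`)

For `N` prime, `1 ≤ m ≤ N`, at Bettin's height `y = 1/(mN²)` and every order `k`:
`‖Σ_n √n J_N(m,n) I_k(n,y)‖ ≤ C_k (1 + log N)^{k+4} √m N⁻¹`, `I_k(n,y) = ∫_y^∞ e^{−2πnv}(log √N v)^k dv`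
(`norm_tsum_sqrt_petJ_axisWeight_le`). Assembly of: the per-term integration by parts and the `Σ_n`/`∫_t` exchange
(`…FirstOrderOffDiagIntegrated`), Bettin's off-diagonal bound at all heights `t ∈ [y, 1]`
(`norm_offDiag_le_of_le_height`, `offDiag_heightBound_le`) and Weil's bound on `t ≥ 1` (`norm_offDiag_le_weil`), with
`|log √N t| ≤ log(mN²) ≤ 3 log N` on `[y,1]` and `∫_y^1 dt/t = log(mN²)`.
Proof only; no definition; nothing about Landau–Siegel zeros; K_A NOT proved.
-/

noncomputable section

open scoped Real
open Complex Set MeasureTheory Filter Topology Finset CongruenceSubgroup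
open Literature.NumberTheory.EllipticCurves.ModularForms
open Literature.NumberTheory.LFunctions Literature.NumberTheory.LFunctions.KMV2000
open Literature.NumberTheory.LFunctions.KowalskiMichel2000

namespace Summit.Parity.GeneralizedHardyLittlewood.Theorems.MomentsBeyondDiagonal.FirstOrderAFE

/-- `m N^{−3/2} ≤ √m / N` for `1 ≤ m ≤ N`. -/
theorem mul_rpow_neg_three_halves_le {m N : ℝ} (hm : 0 < m) (hN : 0 < N) (hmN : m ≤ N) :
    m * N ^ (-(3 / 2 : ℝ)) ≤ Real.sqrt m / N := by
  have hN32 : N ^ (-(3 / 2 : ℝ)) = (N * Real.sqrt N)⁻¹ := by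
    rw [Real.rpow_neg hN.le, Real.sqrt_eq_rpow, ← Real.rpow_one_add' hN.le (by norm_num)]
    norm_num
  rw [hN32, ← div_eq_mul_inv, div_le_div_iff₀ (by positivity) hN]
  have h1 : Real.sqrt m ≤ Real.sqrt N := Real.sqrt_le_sqrt hmN
  have h2 : m = Real.sqrt m * Real.sqrt m := (Real.mul_self_sqrt hm.le).symm
  calc m * N = Real.sqrt m * Real.sqrt m * N := by rw [← h2]
    _ ≤ Real.sqrt m * Real.sqrt N * N := by gcongr
    _ = Real.sqrt m * (N * Real.sqrt N) := by ring

set_option maxHeartbeats 400000 in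
/-- **The height-integrated off-diagonal is `≪_k (1 + log N)^{k+4} √m/N`** (`N` prime, `1 ≤ m ≤ N`, `y = 1/(mN²)`).
[cite: Bettin2017, Thm. 1.1 and §2 (2.3)–(2.5), §4] -/
theorem norm_tsum_sqrt_petJ_axisWeight_le (k : ℕ) :
    ∃ C : ℝ, 0 ≤ C ∧ ∀ (N : ℕ) [NeZero N], N.Prime → ∀ m : ℕ, 1 ≤ m → m ≤ N →
      ‖∑' n : ℕ, ((Real.sqrt n : ℝ) : ℂ) * petJ N m n *
          ((∫ v in Ioi (1 / ((m : ℝ) * (N : ℝ) ^ 2)), Real.exp (-(2 * Real.pi * n) * v) *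
            (Real.log (Real.sqrt N * v)) ^ k : ℝ) : ℂ)‖ ≤
        C * (1 + Real.log N) ^ (k + 4) * Real.sqrt m / N := by
  obtain ⟨Cd, hCd1, hCd⟩ :=
    Literature.NumberTheory.Sieve.exists_card_divisors_le_mul_rpow' (by norm_num : (0 : ℝ) < 1 / 4)
  have hCd0 : 0 ≤ Cd := by linarith
  obtain ⟨K, hK0, hK⟩ := norm_offDiag_le_weil
  set Z : ℝ := ∑' r : ℕ, (((r + 1 : ℕ) : ℝ)) ^ (-(9 / 8 : ℝ)) with hZ
  have hZ0 : 0 ≤ Z := tsum_nonneg fun r ↦ Real.rpow_nonneg (Nat.cast_nonneg _) _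
  set C₀ : ℝ := 2 * π * (2 * π * 9 * 45 * 45 + 8 * Cd * Z) with hC₀
  have hC₀0 : 0 ≤ C₀ := by positivity
  set C₁ : ℝ := 4 * K * k * 2 ^ (k - 1) * (1 + ((k - 1).factorial : ℝ)) with hC₁
  have hC₁0 : 0 ≤ C₁ := by positivity
  refine ⟨(2 * π)⁻¹ * ((3 ^ k + k * 3 ^ (k + 1)) * C₀ + C₁), by positivity, fun N _ hN m hm hmN ↦ ?_⟩
  -- sizes
  have hN2 : (2 : ℝ) ≤ N := by exact_mod_cast hN.two_le
  have hN0 : (0 : ℝ) < N := by linarith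
  have hm1 : (1 : ℝ) ≤ m := by exact_mod_cast hm
  have hm0 : (0 : ℝ) < m := by linarith
  have hmN' : (m : ℝ) ≤ N := by exact_mod_cast hmN
  have hs : 0 < Real.sqrt N := Real.sqrt_pos.mpr hN0
  set L : ℝ := Real.log N with hL
  have hL0 : 0 < L := Real.log_pos (by linarith)
  set y : ℝ := 1 / ((m : ℝ) * (N : ℝ) ^ 2) with hy_def
  have hy : 0 < y := by positivity
  have hy1 : y ≤ 1 := by rw [hy_def, div_le_one (by positivity)]; nlinarith
  set Λ : ℝ := Real.log ((m : ℝ) * (N : ℝ) ^ 2) with hΛ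
  have hΛsplit : Λ = Real.log m + 2 * L := by
    rw [hΛ, Real.log_mul hm0.ne' (by positivity), Real.log_pow, hL]; push_cast; ring
  have hΛL : Λ ≤ 3 * (1 + L) := by rw [hΛsplit]; linarith [Real.log_le_log hm0 hmN']
  have hLΛ : L ≤ Λ := by rw [hΛsplit]; linarith [Real.log_nonneg hm1]
  have hΛ0 : 0 < Λ := lt_of_lt_of_le hL0 hLΛ
  have hlogy : Real.log y = -Λ := by rw [hy_def, one_div, Real.log_inv]
  set B₀ : ℝ := C₀ * (1 + L) ^ 3 * Real.sqrt m / N with hB₀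
  have hB₀0 : 0 ≤ B₀ := by positivity
  -- `|log √N t| ≤ Λ` on `[y, 1]`
  have hlogt : ∀ t : ℝ, y ≤ t → t ≤ 1 → |Real.log (Real.sqrt N * t)| ≤ Λ := by
    intro t hyt ht1
    have ht0 : 0 < t := lt_of_lt_of_le hy hyt
    rw [Real.log_mul hs.ne' ht0.ne', abs_le]
    have hlogN : Real.log (Real.sqrt N) = L / 2 := by rw [Real.log_sqrt hN0.le, hL]
    have h1 : Real.log t ≤ 0 := Real.log_nonpos ht0.le ht1
    have h2 : -Λ ≤ Real.log t := by rw [← hlogy]; exact Real.log_le_log hy hyt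
    constructor <;> linarith
  -- abbreviations for the objects
  obtain ⟨OD, hOD⟩ : ∃ OD : ℝ → ℂ, ∀ t, OD t =
      ∑' n : ℕ, (((n : ℝ) ^ (-(1 / 2 : ℝ)) * Real.exp (-(2 * π * n) * t) : ℝ) : ℂ) * petJ N m n := ⟨_, fun _ ↦ rfl⟩
  obtain ⟨φ, hφ⟩ : ∃ φ : ℝ → ℝ, ∀ t, φ t = (k : ℝ) * (Real.log (Real.sqrt N * t)) ^ (k - 1) * t⁻¹ :=
    ⟨_, fun _ ↦ rfl⟩
  -- the two height bounds
  have hBy : ∀ t : ℝ, y ≤ t → ‖OD t‖ ≤ B₀ := by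
    intro t hyt
    rw [hOD]
    exact (norm_offDiag_le_of_le_height hN hm hy hyt hCd (m ^ 16 * N ^ 28 - 1)).trans
      (offDiag_heightBound_le hCd0 N hN m hm hmN)
  have hW : ∀ t : ℝ, 1 ≤ t → ‖OD t‖ ≤ 4 * K * m * (N : ℝ) ^ (-(3 / 2 : ℝ)) * Real.exp (-(2 * π * t)) :=
    fun t ht ↦ by rw [hOD]; exact (hK N hN m hm t ht).2
  -- Step 1: summability of `n ↦ w_y(n) J(m,n)` (Petersson `J = δ − pet`) and the exchange
  have hS1 : Summable (fun n : ℕ ↦ (((n : ℝ) ^ (-(1 / 2 : ℝ)) * Real.exp (-(2 * π * n) * y) : ℝ) : ℂ) * petJ N m n) := by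
    have hPs : Summable (fun n : ℕ ↦
        (((n : ℝ) ^ (-(1 / 2 : ℝ)) * Real.exp (-(2 * Real.pi * n) * y) : ℝ) : ℂ) * pet N m n) :=
      Summable.of_norm (Bettin2017.harmonicSum_heckeLambda_mul_dampedTwist (N := N) m hy).1
    have hD : Summable (fun n : ℕ ↦ if n = m then
        (((m : ℝ) ^ (-(1 / 2 : ℝ)) * Real.exp (-(2 * Real.pi * m) * y) : ℝ) : ℂ) else 0) :=
      (hasSum_ite_eq m _).summable
    refine (hD.sub hPs).congr fun n ↦ ?_
    rcases Nat.eq_zero_or_pos n with rfl | hn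
    · have h0 : (0 : ℕ) ≠ m := by omega
      simp [h0]
    · rw [(kowalskiMichel2000_peterssonFormula_holds N hN m n hm hn).2]
      by_cases hnm : n = m
      · subst hnm; rw [if_pos rfl, if_pos rfl]; ring
      · rw [if_neg hnm, if_neg (Ne.symm hnm)]; ring
  obtain ⟨hS2, hex⟩ := tsum_petJ_weight_integral_eq hN hm hy k
  -- the termwise identity
  set g : ℝ := (Real.log (Real.sqrt N * y)) ^ k with hg
  have hterm : ∀ n : ℕ, ((Real.sqrt n : ℝ) : ℂ) * petJ N m n *
      ((∫ v in Ioi y, Real.exp (-(2 * Real.pi * n) * v) * (Real.log (Real.sqrt N * v)) ^ k : ℝ) : ℂ) =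
      (((2 * π)⁻¹ : ℝ) : ℂ) * ((((n : ℝ) ^ (-(1 / 2 : ℝ)) * Real.exp (-(2 * π * n) * y) : ℝ) : ℂ) *
          petJ N m n * (g : ℂ)) +
        (((2 * π)⁻¹ : ℝ) : ℂ) * (petJ N m n * (((n : ℝ) ^ (-(1 / 2 : ℝ)) : ℝ) : ℂ) *
          ((∫ v in Ioi y, Real.exp (-(2 * Real.pi * n) * v) *
            ((k : ℝ) * (Real.log (Real.sqrt N * v)) ^ (k - 1) * v⁻¹) : ℝ) : ℂ)) := by
    intro n
    rcases Nat.eq_zero_or_pos n with rfl | hn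
    · simp
    · have h := congrArg (fun x : ℝ ↦ (x : ℂ)) (sqrt_mul_axisWeight_eq (N := N) hn hy k)
      rw [hg]
      push_cast at h ⊢
      linear_combination (petJ N m n) * h
  -- Step 2: the sum splits into the height-`y` term and the height integral
  have hsum_eq : ∑' n : ℕ, ((Real.sqrt n : ℝ) : ℂ) * petJ N m n *
      ((∫ v in Ioi y, Real.exp (-(2 * Real.pi * n) * v) * (Real.log (Real.sqrt N * v)) ^ k : ℝ) : ℂ) =
      (((2 * π)⁻¹ : ℝ) : ℂ) * (OD y * (g : ℂ)) +
        (((2 * π)⁻¹ : ℝ) : ℂ) * ∫ t in Ioi y, ((φ t : ℝ) : ℂ) * OD t := by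
    rw [tsum_congr hterm, (((hS1.mul_right _).mul_left _).hasSum.add (hS2.mul_left _).hasSum).tsum_eq,
      tsum_mul_left, tsum_mul_left, tsum_mul_right, hex, hOD]
    congr 2
    refine setIntegral_congr_fun measurableSet_Ioi fun t _ ↦ ?_
    rw [hφ, hOD]
  -- Step 3: the pointwise majorant of the height integrand
  set G : ℝ → ℝ := fun t ↦ if t ≤ 1 then ((k : ℝ) * Λ ^ (k - 1) * B₀) * t⁻¹
      else (4 * K * m * (N : ℝ) ^ (-(3 / 2 : ℝ)) * k) *
        (Real.exp (-(2 * π * t)) * (Real.log (Real.sqrt N * t)) ^ (k - 1)) with hG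
  have hptw : ∀ t ∈ Ioi y, ‖((φ t : ℝ) : ℂ) * OD t‖ ≤ G t := by
    intro t ht
    have ht : y < t := ht
    have ht0 : 0 < t := hy.trans ht
    rw [norm_mul, Complex.norm_real, Real.norm_eq_abs, hφ]
    by_cases ht1 : t ≤ 1
    · rw [hG]; simp only [if_pos ht1]
      have h1 : |(k : ℝ) * Real.log (Real.sqrt N * t) ^ (k - 1) * t⁻¹| ≤ (k : ℝ) * Λ ^ (k - 1) * t⁻¹ := by
        rw [abs_mul, abs_mul, abs_of_nonneg (Nat.cast_nonneg k), abs_pow, abs_of_pos (inv_pos.mpr ht0)]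
        gcongr
        exact hlogt t ht.le ht1
      calc |(k : ℝ) * Real.log (Real.sqrt N * t) ^ (k - 1) * t⁻¹| * ‖OD t‖ ≤ ((k : ℝ) * Λ ^ (k - 1) * t⁻¹) * B₀ :=
            mul_le_mul h1 (hBy t ht.le) (norm_nonneg _) (by positivity)
        _ = _ := by ring
    · rw [hG]; simp only [if_neg ht1]
      have ht1' : 1 ≤ t := (not_le.mp ht1).le
      obtain ⟨hl0, _⟩ := log_sqrt_mul_bounds (N := N) ht1'
      have h1 : |(k : ℝ) * Real.log (Real.sqrt N * t) ^ (k - 1) * t⁻¹| ≤ (k : ℝ) * Real.log (Real.sqrt N * t) ^ (k - 1) := by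
        rw [abs_mul, abs_mul, abs_of_nonneg (Nat.cast_nonneg k), abs_pow, abs_of_nonneg hl0,
          abs_of_pos (inv_pos.mpr ht0)]
        exact mul_le_of_le_one_right (by positivity) (inv_le_one_of_one_le₀ ht1')
      calc |(k : ℝ) * Real.log (Real.sqrt N * t) ^ (k - 1) * t⁻¹| * ‖OD t‖
          ≤ ((k : ℝ) * Real.log (Real.sqrt N * t) ^ (k - 1)) * (4 * K * m * (N : ℝ) ^ (-(3 / 2 : ℝ)) * Real.exp (-(2 * π * t))) :=
            mul_le_mul h1 (hW t ht1') (norm_nonneg _) (by positivity)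
        _ = _ := by ring
  -- integrability of the majorant on `(y,1]` and `(1,∞)`
  have hGint1 : IntegrableOn G (Ioc y 1) := by
    have hcont : ContinuousOn (fun t : ℝ ↦ ((k : ℝ) * Λ ^ (k - 1) * B₀) * t⁻¹) (Icc y 1) :=
      continuousOn_const.mul (continuousOn_inv₀.mono fun t ht ↦ (lt_of_lt_of_le hy ht.1).ne')
    refine IntegrableOn.congr_fun (hcont.integrableOn_Icc.mono_set Ioc_subset_Icc_self) (fun t ht ↦ ?_)
      measurableSet_Ioc
    rw [hG]; simp only [if_pos ht.2]
  have hGint2 : IntegrableOn G (Ioi 1) := by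
    have h := (integrableOn_exp_abs_logPow_Ioi (N := N) (k - 1) zero_le_one).const_mul
      (4 * K * m * (N : ℝ) ^ (-(3 / 2 : ℝ)) * k)
    refine IntegrableOn.congr_fun h (fun t ht ↦ ?_) measurableSet_Ioi
    have ht : 1 < t := ht
    rw [hG]; simp only [if_neg (not_le.mpr ht)]
    rw [abs_of_nonneg (log_sqrt_mul_bounds (N := N) ht.le).1]
  have hGint : IntegrableOn G (Ioi y) := by
    rw [← Ioc_union_Ioi_eq_Ioi hy1]; exact hGint1.union hGint2
  have hint_le : ‖∫ t in Ioi y, ((φ t : ℝ) : ℂ) * OD t‖ ≤ ∫ t in Ioi y, G t :=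
    norm_integral_le_of_norm_le hGint ((ae_restrict_iff' measurableSet_Ioi).mpr (Filter.Eventually.of_forall hptw))
  -- the value of the majorant integral
  have hG1 : ∫ t in Ioc y 1, G t = ((k : ℝ) * Λ ^ (k - 1) * B₀) * Λ := by
    rw [setIntegral_congr_fun measurableSet_Ioc (fun t ht ↦ by rw [hG]; simp only [if_pos ht.2] :
      EqOn G (fun t ↦ ((k : ℝ) * Λ ^ (k - 1) * B₀) * t⁻¹) (Ioc y 1)), integral_const_mul,
      ← intervalIntegral.integral_of_le hy1, integral_inv_of_pos hy one_pos, one_div, Real.log_inv, hlogy, neg_neg]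
  have hG2 : ∫ t in Ioi 1, G t ≤ C₁ * (1 + L) ^ (k - 1) * (m * (N : ℝ) ^ (-(3 / 2 : ℝ))) := by
    rw [setIntegral_congr_fun measurableSet_Ioi (fun t ht ↦ by
        have ht : 1 < t := ht
        rw [hG]; simp only [if_neg (not_le.mpr ht)] :
      EqOn G (fun t ↦ (4 * K * m * (N : ℝ) ^ (-(3 / 2 : ℝ)) * k) *
        (Real.exp (-(2 * π * t)) * (Real.log (Real.sqrt N * t)) ^ (k - 1))) (Ioi 1)), integral_const_mul]
    have htail := integral_exp_mul_logPow_tail_le (N := N) le_rfl (k - 1)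
    have hlogN : Real.log (Real.sqrt N) = L / 2 := by rw [Real.log_sqrt hN0.le, hL]
    have hA : (Real.log (Real.sqrt N)) ^ (k - 1) ≤ (1 + L) ^ (k - 1) := by
      rw [hlogN]; exact pow_le_pow_left₀ (by positivity) (by linarith) _
    have hB : ((k - 1).factorial : ℝ) / π ^ (k - 1) ≤ ((k - 1).factorial : ℝ) * (1 + L) ^ (k - 1) := by
      have h1 : ((k - 1).factorial : ℝ) / π ^ (k - 1) ≤ (k - 1).factorial :=
        div_le_self (by positivity) (one_le_pow₀ (by linarith [Real.pi_gt_three]))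
      exact h1.trans (le_mul_of_one_le_right (by positivity) (one_le_pow₀ (by linarith)))
    have hC : Real.exp (-(π * 1)) / π ≤ 1 := by
      rw [div_le_one Real.pi_pos, mul_one]
      exact (Real.exp_le_one_iff.mpr (by linarith [Real.pi_pos])).trans (by linarith [Real.pi_gt_three])
    have hfac : 0 ≤ 4 * K * m * (N : ℝ) ^ (-(3 / 2 : ℝ)) * k := by positivity
    calc (4 * K * m * (N : ℝ) ^ (-(3 / 2 : ℝ)) * k) *
          ∫ t in Ioi 1, Real.exp (-(2 * π * t)) * (Real.log (Real.sqrt N * t)) ^ (k - 1)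
        ≤ (4 * K * m * (N : ℝ) ^ (-(3 / 2 : ℝ)) * k) *
            (2 ^ (k - 1) * ((Real.log (Real.sqrt N)) ^ (k - 1) + ((k - 1).factorial : ℝ) / π ^ (k - 1)) *
              (Real.exp (-(π * 1)) / π)) := mul_le_mul_of_nonneg_left htail hfac
      _ ≤ (4 * K * m * (N : ℝ) ^ (-(3 / 2 : ℝ)) * k) *
            (2 ^ (k - 1) * ((1 + L) ^ (k - 1) + ((k - 1).factorial : ℝ) * (1 + L) ^ (k - 1)) * 1) := by
          gcongr
      _ = C₁ * (1 + L) ^ (k - 1) * (m * (N : ℝ) ^ (-(3 / 2 : ℝ))) := by rw [hC₁]; ring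
  have hG_split : ∫ t in Ioi y, G t = (∫ t in Ioc y 1, G t) + ∫ t in Ioi 1, G t := by
    rw [← Ioc_union_Ioi_eq_Ioi hy1]
    exact setIntegral_union (Set.disjoint_left.mpr fun t ht ht' ↦ (not_lt.mpr ht.2) ht') measurableSet_Ioi hGint1 hGint2
  -- Step 4: assemble the numbers
  have hgy : ‖(g : ℂ)‖ ≤ Λ ^ k := by
    rw [Complex.norm_real, Real.norm_eq_abs, hg, abs_pow]
    exact pow_le_pow_left₀ (abs_nonneg _) (hlogt y le_rfl hy1) k
  have h1L : (1 : ℝ) ≤ 1 + L := by linarith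
  have hΛk : Λ ^ k ≤ 3 ^ k * (1 + L) ^ k := by
    rw [← mul_pow]; exact pow_le_pow_left₀ hΛ0.le hΛL k
  have hΛk1 : Λ ^ (k - 1) * Λ ≤ 3 ^ (k + 1) * (1 + L) ^ (k + 1) := by
    have h1 : Λ ^ (k - 1) ≤ (3 * (1 + L)) ^ (k - 1) := pow_le_pow_left₀ hΛ0.le hΛL _
    have h2 : (3 * (1 + L)) ^ (k - 1) ≤ (3 * (1 + L)) ^ k := pow_le_pow_right₀ (by linarith) (Nat.sub_le k 1)
    calc Λ ^ (k - 1) * Λ ≤ (3 * (1 + L)) ^ k * (3 * (1 + L)) := mul_le_mul (h1.trans h2) hΛL hΛ0.le (by positivity)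
      _ = 3 ^ (k + 1) * (1 + L) ^ (k + 1) := by rw [← pow_succ, mul_pow]
  have hmN32 : (m : ℝ) * (N : ℝ) ^ (-(3 / 2 : ℝ)) ≤ Real.sqrt m / N := mul_rpow_neg_three_halves_le hm0 hN0 hmN'
  have hpow1 : (1 + L) ^ (k - 1) ≤ (1 + L) ^ (k + 4) := pow_le_pow_right₀ h1L (by omega)
  have hpow2 : (1 + L) ^ k * (1 + L) ^ 3 ≤ (1 + L) ^ (k + 4) := by
    rw [← pow_add]; exact pow_le_pow_right₀ h1L (by omega)
  have hpow3 : (1 + L) ^ (k + 1) * (1 + L) ^ 3 = (1 + L) ^ (k + 4) := by rw [← pow_add]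
  -- part 1: the height-`y` term
  have hP1 : ‖OD y * (g : ℂ)‖ ≤ 3 ^ k * C₀ * ((1 + L) ^ (k + 4) * Real.sqrt m / N) := by
    calc ‖OD y * (g : ℂ)‖ ≤ B₀ * Λ ^ k := by rw [norm_mul]; exact mul_le_mul (hBy y le_rfl) hgy (norm_nonneg _) hB₀0
      _ ≤ (C₀ * (1 + L) ^ 3 * Real.sqrt m / N) * (3 ^ k * (1 + L) ^ k) := mul_le_mul_of_nonneg_left hΛk hB₀0
      _ = 3 ^ k * C₀ * (((1 + L) ^ k * (1 + L) ^ 3) * Real.sqrt m / N) := by ring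
      _ ≤ 3 ^ k * C₀ * ((1 + L) ^ (k + 4) * Real.sqrt m / N) := by gcongr
  -- part 2: the height integral
  have hP2 : ‖∫ t in Ioi y, ((φ t : ℝ) : ℂ) * OD t‖ ≤ (k * 3 ^ (k + 1) * C₀ + C₁) * ((1 + L) ^ (k + 4) * Real.sqrt m / N) := by
    refine hint_le.trans ?_
    rw [hG_split, hG1]
    have e1 : (k : ℝ) * Λ ^ (k - 1) * B₀ * Λ ≤ k * 3 ^ (k + 1) * C₀ * ((1 + L) ^ (k + 4) * Real.sqrt m / N) := by
      calc (k : ℝ) * Λ ^ (k - 1) * B₀ * Λ = (k : ℝ) * (Λ ^ (k - 1) * Λ) * B₀ := by ring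
        _ ≤ (k : ℝ) * (3 ^ (k + 1) * (1 + L) ^ (k + 1)) * B₀ := by gcongr
        _ = k * 3 ^ (k + 1) * C₀ * (((1 + L) ^ (k + 1) * (1 + L) ^ 3) * Real.sqrt m / N) := by rw [hB₀]; ring
        _ = k * 3 ^ (k + 1) * C₀ * ((1 + L) ^ (k + 4) * Real.sqrt m / N) := by rw [hpow3]
    have e2 : ∫ t in Ioi 1, G t ≤ C₁ * ((1 + L) ^ (k + 4) * Real.sqrt m / N) := by
      refine hG2.trans ?_
      calc C₁ * (1 + L) ^ (k - 1) * (m * (N : ℝ) ^ (-(3 / 2 : ℝ))) ≤ C₁ * (1 + L) ^ (k + 4) * (Real.sqrt m / N) := by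
            gcongr
        _ = C₁ * ((1 + L) ^ (k + 4) * Real.sqrt m / N) := by ring
    linarith
  -- total
  rw [hsum_eq]
  have hnorm2π : ‖(((2 * π)⁻¹ : ℝ) : ℂ)‖ = (2 * π)⁻¹ := by
    rw [Complex.norm_real, Real.norm_of_nonneg (by positivity)]
  have hX : ‖(((2 * π)⁻¹ : ℝ) : ℂ) * (OD y * (g : ℂ))‖ ≤ (2 * π)⁻¹ * (3 ^ k * C₀ * ((1 + L) ^ (k + 4) * Real.sqrt m / N)) := by
    rw [norm_mul, hnorm2π]; exact mul_le_mul_of_nonneg_left hP1 (by positivity)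
  have hY : ‖(((2 * π)⁻¹ : ℝ) : ℂ) * ∫ t in Ioi y, ((φ t : ℝ) : ℂ) * OD t‖ ≤
      (2 * π)⁻¹ * ((k * 3 ^ (k + 1) * C₀ + C₁) * ((1 + L) ^ (k + 4) * Real.sqrt m / N)) := by
    rw [norm_mul, hnorm2π]; exact mul_le_mul_of_nonneg_left hP2 (by positivity)
  calc ‖(((2 * π)⁻¹ : ℝ) : ℂ) * (OD y * (g : ℂ)) + (((2 * π)⁻¹ : ℝ) : ℂ) * ∫ t in Ioi y, ((φ t : ℝ) : ℂ) * OD t‖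
      ≤ (2 * π)⁻¹ * (3 ^ k * C₀ * ((1 + L) ^ (k + 4) * Real.sqrt m / N)) +
          (2 * π)⁻¹ * ((k * 3 ^ (k + 1) * C₀ + C₁) * ((1 + L) ^ (k + 4) * Real.sqrt m / N)) :=
        (norm_add_le _ _).trans (add_le_add hX hY)
    _ = (2 * π)⁻¹ * ((3 ^ k + k * 3 ^ (k + 1)) * C₀ + C₁) * (1 + L) ^ (k + 4) * Real.sqrt m / N := by ring

end Summit.Parity.GeneralizedHardyLittlewood.Theorems.MomentsBeyondDiagonal.FirstOrderAFE

end
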